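import Literature.AnabelianGeometry.SemiGraphs.TemperedLevelPairsOfPersistent
import Literature.AnabelianGeometry.SemiGraphs.SubdivisionPathFolding
import Literature.AnabelianGeometry.SemiGraphs.FreeGroupsAndActionsProofs2
import Mathlib.Data.Set.Finite.Lattice
import HarnessLib

/-!
# [SemiAnbd] Thm 3.7 (iii) beyond finite `𝔾`: at a LOCALLY FINITE `𝔾` a persistent base vertex forces point- or edge-sized images of the fixed loci

Mochizuki, *Semi-graphs of anabelioids*, Publ. RIMS **42** (2006), §3, Theorem 3.7 (iii), manuscript
p. 41, with the author's *Comments* (2020) (6)(b) ("each of the nonempty sets `E_{j,i}`, for `i, j ∈ J`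
such that `i` is 'sufficiently large' relative to `j`, is of cardinality 1")
[cite: MochizukiSemiAnbd2006, Thm 3.7(iii) p.41].

PROOF-ONLY (cell abc-iut, layer L3, row T37iii·LOCFIN-PERSIST (B3), L3-lead ruling α91; seat
abc-iut-w6-d066; no definition, no new named fact).  MAIN theorem `pointOrEdge_images_of_persistent`: for
the abstract level data with levels / immersions / finite fibres / (I4′)_cpt as in
`TemperedLevelPairsOfPersistent.lean`, at a LOCALLY FINITE `𝔾`, a compact `C ≠ 1` with a persistent base
vertex has, for every level `j`, a level `k ≥ j` such that the image in `𝒢_{∞,j}` of the `C`-fixed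
vertices of `𝒢_{∞,k}` is ONE vertex or lies inside the end-vertices of ONE edge.  The finitely many
level-`j` branch pairs at or next to the compatible base point are exhausted by
`eventually_no_unfolded_pair_over`; every other fixed vertex is reached from the fixed base vertex by a
fixed tree path which, by `SemiGraph.exists_endpoint_or_unfolded_of_isPath`, cannot unfold next to the
base point, hence folds entirely.  This is the vertical half of the cell's open core G-t6g3-2b closed
POSITIVELY at locally finite graphs (the «torsor / drift» regime included); the horizontal half fails in
general (countermodel `𝒢_θ`).  Nothing here bears on [IUTchIII] Cor. 3.12.
-/

namespace Literature.AnabelianGeometry.SemiGraphs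

namespace ProfiniteSemiGraph

namespace VerticialLevelData

open CategoryTheory Topology

universe v u

variable {𝒢 : ProfiniteSemiGraph.{u}} {c : TemperedPiChart 𝒢} (D : VerticialLevelData.{v} 𝒢 c)

section Levels

/-! ### The level structure (abstract): levels, immersions, actions, transitions, projections -/

variable (level : D.J → SemiGraph.{u}) (quot : ∀ j, D.tree j ⟶ level j)
  (levelAct : ∀ j, c.G →* Aut (level j))
  (levelTrans : ∀ ⦃i j : D.J⦄, i ≤ j → (level j ⟶ level i))
  (levelProj : ∀ j, level j ⟶ 𝒢.graph)

/-- **MAIN — point- or edge-sized images of the fixed loci over a persistent vertex of a locally finite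
`𝔾`** ([SemiAnbd] Thm 3.7 (iii) p. 41 / Comments (2020) (6)(b) "each of the nonempty sets `E_{j,i}`, for
… `i` sufficiently large relative to `j`, is of cardinality 1", in the localised form valid beyond finite
`𝔾`): `C` compact `≠ 1`, `𝔾` locally finite, `v` a persistent base vertex of `C`.  Then for every level `j`
there is `k ≥ j` such that the image in `𝒢_{∞,j}` of the `C`-fixed vertices of `𝒢_{∞,k}` is ONE vertex, or
lies inside the end-vertices of ONE edge.  Proof: Kőnig gives compatible level base points `x̄` under fixed
tree vertices `x_k` (`levelSystem_of_persistent`); the finitely many level-`j` branch pairs at `x̄_j` or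
next to it are exhausted by `eventually_no_unfolded_pair_over`; then every fixed `x` of a far level `k` is
joined to `x_k` by a fixed tree path which (`SemiGraph.exists_endpoint_or_unfolded_of_isPath`) cannot
unfold next to the image of `x_k`, so folds entirely: `x` maps to an end-vertex of the image edge of the
path's first branch at `x_k`; two such first branches with distinct images would be an unfolded fixed pair
AT `x_k` — also exhausted. [cite: MochizukiSemiAnbd2006, Thm 3.7(iii) p.41] -/
theorem pointOrEdge_images_of_persistent (h𝒢 : 𝒢.Thm37Hypotheses) (C : Subgroup c.G) (hC1 : C ≠ ⊥)
    (quot_isImmersion : ∀ j, SemiGraph.IsImmersion (quot j))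
    (act_quot : ∀ (j : D.J) (g : c.G), (D.act j g).hom ≫ quot j = quot j ≫ (levelAct j g).hom)
    (trans_quot : ∀ ⦃i j : D.J⦄ (h : i ≤ j), D.trans h ≫ quot i = quot j ≫ levelTrans h)
    (levelTrans_id : ∀ j, levelTrans (le_refl j) = 𝟙 (level j))
    (levelTrans_comp : ∀ ⦃i j k : D.J⦄ (hij : i ≤ j) (hjk : j ≤ k),
      levelTrans hjk ≫ levelTrans hij = levelTrans (hij.trans hjk))
    (quot_proj : ∀ j, quot j ≫ levelProj j = D.proj j)
    (levelTrans_proj : ∀ ⦃i j : D.J⦄ (h : i ≤ j), levelTrans h ≫ levelProj i = levelProj j)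
    (finV : ∀ (j : D.J) (v : 𝒢.graph.Vertex), {w : (level j).Vertex | (levelProj j).vertexMap w = v}.Finite)
    (finB : ∀ (j : D.J) (b : 𝒢.graph.Branch), {β : (level j).Branch | (levelProj j).branchMap β = b}.Finite)
    (hlf : ∀ v : 𝒢.graph.Vertex, {b : 𝒢.graph.Branch | 𝒢.graph.abuts b = some v}.Finite)
    (stabC : ∀ (j₀ : D.J) (w : ∀ i : {i : D.J // j₀ ≤ i}, (level i.1).Vertex)
      (β β' : ∀ i : {i : D.J // j₀ ≤ i}, (level i.1).Branch),
      (∀ i, β i ≠ β' i ∧ (level i.1).abuts (β i) = some (w i) ∧ (level i.1).abuts (β' i) = some (w i)) →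
      (∀ ⦃i i' : {i : D.J // j₀ ≤ i}⦄ (h : i.1 ≤ i'.1), (levelTrans h).vertexMap (w i') = w i ∧
        (levelTrans h).branchMap (β i') = β i ∧ (levelTrans h).branchMap (β' i') = β' i) →
      ∃ (Q : Type u) (_ : Group Q) (ιQ : c.G →* Q) (v : 𝒢.graph.Vertex) (b b' : 𝒢.graph.Branch)
        (hb : 𝒢.graph.abuts b = some v) (hb' : 𝒢.graph.abuts b' = some v) (ψ : 𝒢.Gv v →* Q) (x x' : 𝒢.Gv v),
        Set.InjOn ιQ C ∧ Function.Injective ψ ∧ (b' ≠ b ∨ x⁻¹ * x' ∉ 𝒢.branchSubgroup b v hb) ∧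
        ∀ g ∈ C, (∀ i, (levelAct i.1 g).hom.vertexMap (w i) = w i ∧
          (levelAct i.1 g).hom.branchMap (β i) = β i ∧ (levelAct i.1 g).hom.branchMap (β' i) = β' i) →
          ιQ g ∈ ((𝒢.branchSubgroup b v hb).map (MulAut.conj x).toMonoidHom).map ψ ⊓
            ((𝒢.branchSubgroup b' v hb').map (MulAut.conj x').toMonoidHom).map ψ)
    (v : 𝒢.graph.Vertex)
    (hpers : ∀ j, ∃ x : (D.tree j).Vertex, (D.proj j).vertexMap x = v ∧
      ∀ g ∈ C, (D.act j g).hom.vertexMap x = x) (j : D.J) :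
    ∃ (k : D.J) (h : j ≤ k),
      (∃ y : (D.tree j).Vertex, ∀ x : (D.tree k).Vertex, (∀ g ∈ C, (D.act k g).hom.vertexMap x = x) →
        (D.trans h).vertexMap x = y) ∨
      (∃ e : (D.tree j).Edge, ∀ x : (D.tree k).Vertex, (∀ g ∈ C, (D.act k g).hom.vertexMap x = x) →
        ∃ b : (D.tree j).Branch, (D.tree j).edgeOf b = e ∧ (D.tree j).abuts b = some ((D.trans h).vertexMap x)) := by
  classical
  -- pointwise squares
  have tq_v : ∀ ⦃i k : D.J⦄ (h : i ≤ k) (x : (D.tree k).Vertex),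
      (quot i).vertexMap ((D.trans h).vertexMap x) = (levelTrans h).vertexMap ((quot k).vertexMap x) :=
    fun i k h x => by
      have e := congrArg (fun ψ => SemiGraph.Hom.vertexMap ψ x) (trans_quot h)
      simpa only [SemiGraph.comp_vertexMap, Function.comp_apply] using e
  have tq_b : ∀ ⦃i k : D.J⦄ (h : i ≤ k) (b : (D.tree k).Branch),
      (quot i).branchMap ((D.trans h).branchMap b) = (levelTrans h).branchMap ((quot k).branchMap b) :=
    fun i k h b => by
      have e := congrArg (fun ψ => SemiGraph.Hom.branchMap ψ b) (trans_quot h)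
      simpa only [SemiGraph.comp_branchMap, Function.comp_apply] using e
  have imm : ∀ (i : D.J) (w : (D.tree i).Vertex) (cc cc' : (D.tree i).Branch), cc ≠ cc' →
      (D.tree i).abuts cc = some w → (D.tree i).abuts cc' = some w →
      (quot i).branchMap cc ≠ (quot i).branchMap cc' := by
    intro i w cc cc' hne hcc hcc' h
    have := quot_isImmersion i w (a₁ := ⟨cc, hcc⟩) (a₂ := ⟨cc', hcc'⟩) (Subtype.ext h)
    exact hne (congrArg Subtype.val this)
  -- (K) compatible level base points under fixed tree vertices
  obtain ⟨xbar, hxbar, hxdata⟩ := D.levelSystem_of_persistent level quot levelTrans levelProj C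
    trans_quot levelTrans_id levelTrans_comp quot_proj levelTrans_proj finV v hpers
  -- the finitely many level-`j` vertices at or next to `x̄ j`, and branch pairs there
  let N₁ : Set (level j).Vertex := {w | w = xbar j ∨ ∃ β d : (level j).Branch,
    (level j).abuts β = some (xbar j) ∧ (level j).edgeOf d = (level j).edgeOf β ∧ (level j).abuts d = some w}
  have hN₁ : N₁.Finite := by
    have hB : {β : (level j).Branch | (level j).abuts β = some (xbar j)}.Finite :=
      D.finite_levelStar level levelProj finB hlf j (xbar j)
    have hDs : {d : (level j).Branch | ∃ β : (level j).Branch, (level j).abuts β = some (xbar j) ∧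
        (level j).edgeOf d = (level j).edgeOf β}.Finite := by
      refine ((hB.biUnion fun β _ => ?_ : (⋃ β ∈ {β : (level j).Branch | (level j).abuts β = some (xbar j)},
        {d : (level j).Branch | (level j).edgeOf d = (level j).edgeOf β}).Finite)).subset ?_
      · obtain ⟨b₁, b₂, -, -, -, hall⟩ := (level j).two_branches ((level j).edgeOf β)
        refine ((Set.finite_singleton b₂).insert b₁).subset fun d hd => ?_
        rcases hall d hd with rfl | rfl
        · exact Set.mem_insert _ _
        · exact Set.mem_insert_of_mem _ rfl
      · intro d hd
        simp only [Set.mem_iUnion, Set.mem_setOf_eq, exists_prop]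
        exact hd
    refine (((hDs.image fun d => (level j).abuts d).preimage
      (Set.injOn_of_injective (Option.some_injective _))).insert (xbar j)).subset ?_
    rintro w (rfl | ⟨β, d, hβ, hd, hdw⟩)
    · exact Set.mem_insert _ _
    · exact Set.mem_insert_of_mem _ ⟨d, ⟨β, hβ, hd⟩, hdw⟩
  let Q : Set ((level j).Vertex × (level j).Branch × (level j).Branch) :=
    {τ | τ.1 ∈ N₁ ∧ (level j).abuts τ.2.1 = some τ.1 ∧ (level j).abuts τ.2.2 = some τ.1 ∧ τ.2.1 ≠ τ.2.2}
  have hQ : Q.Finite := by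
    have hBn : {β : (level j).Branch | ∃ w ∈ N₁, (level j).abuts β = some w}.Finite := by
      refine ((hN₁.biUnion fun w _ => D.finite_levelStar level levelProj finB hlf j w)).subset ?_
      rintro β ⟨w, hw, hβ⟩
      simp only [Set.mem_iUnion, Set.mem_setOf_eq, exists_prop]
      exact ⟨w, hw, hβ⟩
    refine (hN₁.prod (hBn.prod hBn)).subset ?_
    rintro τ ⟨h1, h2, h3, -⟩
    exact ⟨h1, ⟨τ.1, h1, h2⟩, ⟨τ.1, h1, h3⟩⟩
  -- exhaust the pairs of `Q`: one level beyond which none of them is hit by an unfolded fixed tree pair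
  have hB := fun (τ : (level j).Vertex × (level j).Branch × (level j).Branch) (hτ : τ.2.1 ≠ τ.2.2) =>
    D.eventually_no_unfolded_pair_over level quot levelAct levelTrans levelProj h𝒢 C hC1 quot_isImmersion
      act_quot trans_quot levelTrans_id levelTrans_comp levelTrans_proj finV finB stabC j τ.1 τ.2.1 τ.2.2 hτ
  let kk : (level j).Vertex × (level j).Branch × (level j).Branch → D.J := fun τ =>
    if hτ : τ.2.1 ≠ τ.2.2 then (hB τ hτ).choose else j
  have hkk : ∀ τ (hτ : τ.2.1 ≠ τ.2.2), j ≤ kk τ ∧ ∀ (k : D.J), kk τ ≤ k → ∀ (h : j ≤ k),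
      ¬ ∃ (w : (D.tree k).Vertex) (cc cc' : (D.tree k).Branch), cc ≠ cc' ∧
        (D.tree k).abuts cc = some w ∧ (D.tree k).abuts cc' = some w ∧
        (∀ g ∈ C, (D.act k g).hom.vertexMap w = w ∧ (D.act k g).hom.branchMap cc = cc ∧
          (D.act k g).hom.branchMap cc' = cc') ∧
        (levelTrans h).vertexMap ((quot k).vertexMap w) = τ.1 ∧
        (levelTrans h).branchMap ((quot k).branchMap cc) = τ.2.1 ∧
        (levelTrans h).branchMap ((quot k).branchMap cc') = τ.2.2 := by
    intro τ hτ
    have hdef : kk τ = (hB τ hτ).choose := dif_pos hτ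
    obtain ⟨h₀, hspec⟩ := (hB τ hτ).choose_spec
    refine ⟨hdef ▸ h₀, fun k hk h => ?_⟩
    rw [hdef] at hk
    exact hspec k hk
  haveI : Nonempty D.J := D.nonempty
  obtain ⟨K, hK⟩ := (hQ.image kk).bddAbove
  obtain ⟨k, hjk, hKk⟩ := exists_ge_ge j K
  refine ⟨k, hjk, ?_⟩
  have hnobad : ∀ τ ∈ Q, ¬ ∃ (w : (D.tree k).Vertex) (cc cc' : (D.tree k).Branch), cc ≠ cc' ∧
        (D.tree k).abuts cc = some w ∧ (D.tree k).abuts cc' = some w ∧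
        (∀ g ∈ C, (D.act k g).hom.vertexMap w = w ∧ (D.act k g).hom.branchMap cc = cc ∧
          (D.act k g).hom.branchMap cc' = cc') ∧
        (levelTrans hjk).vertexMap ((quot k).vertexMap w) = τ.1 ∧
        (levelTrans hjk).branchMap ((quot k).branchMap cc) = τ.2.1 ∧
        (levelTrans hjk).branchMap ((quot k).branchMap cc') = τ.2.2 := fun τ hτ =>
    (hkk τ hτ.2.2.2).2 k ((hK ⟨τ, hτ, rfl⟩).trans hKk) hjk
  -- the fixed base vertex `x_k` over `x̄ k` and its image `y` at level `j` (over `x̄ j`)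
  obtain ⟨-, x₀, hx₀, hqx₀⟩ := hxdata k
  set φ := D.trans hjk with hφ
  have hqy : (quot j).vertexMap (φ.vertexMap x₀) = xbar j := by rw [tq_v hjk, hqx₀, hxbar hjk]
  -- fixed branches from fixed branch-nodes
  have fixB_of_node : ∀ (cc : (D.tree k).Branch),
      (∀ g ∈ C, SemiGraph.nodeMap (D.act k g) (Sum.inr (Sum.inr cc)) = Sum.inr (Sum.inr cc)) →
      ∀ g ∈ C, (D.act k g).hom.branchMap cc = cc := by
    intro cc h g hg
    have := h g hg
    simpa [SemiGraph.nodeMap] using this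
  have fixV_of_node : ∀ (w : (D.tree k).Vertex),
      (∀ g ∈ C, SemiGraph.nodeMap (D.act k g) (Sum.inl w) = Sum.inl w) →
      ∀ g ∈ C, (D.act k g).hom.vertexMap w = w := by
    intro w h g hg
    have := h g hg
    simpa [SemiGraph.nodeMap] using this
  -- an unfolded fixed pair whose image vertex is at or next to `y` is a bad pair over `Q` — excluded
  have excl : ∀ (w : (D.tree k).Vertex) (cc cc' : (D.tree k).Branch), cc ≠ cc' →
      (D.tree k).abuts cc = some w → (D.tree k).abuts cc' = some w →
      (∀ g ∈ C, (D.act k g).hom.vertexMap w = w ∧ (D.act k g).hom.branchMap cc = cc ∧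
        (D.act k g).hom.branchMap cc' = cc') →
      φ.branchMap cc ≠ φ.branchMap cc' →
      (quot j).vertexMap (φ.vertexMap w) ∈ N₁ → False := by
    intro w cc cc' hne hcc hcc' hfix hunf hN
    refine hnobad ((quot j).vertexMap (φ.vertexMap w), (quot j).branchMap (φ.branchMap cc),
      (quot j).branchMap (φ.branchMap cc')) ⟨hN, ?_, ?_, ?_⟩ ⟨w, cc, cc', hne, hcc, hcc', hfix, ?_, ?_, ?_⟩
    · exact (quot j).abuts_branchMap _ _ (φ.abuts_branchMap cc w hcc)
    · exact (quot j).abuts_branchMap _ _ (φ.abuts_branchMap cc' w hcc')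
    · exact imm j (φ.vertexMap w) _ _ hunf (φ.abuts_branchMap cc w hcc) (φ.abuts_branchMap cc' w hcc')
    · exact (tq_v hjk w).symm
    · exact (tq_b hjk cc).symm
    · exact (tq_b hjk cc').symm
  -- R(x): every fixed `x ≠ x₀` maps to an end-vertex of the image edge of a fixed branch at `x₀`
  have R : ∀ (x : (D.tree k).Vertex), (∀ g ∈ C, (D.act k g).hom.vertexMap x = x) → x ≠ x₀ →
      ∃ c₀ : (D.tree k).Branch, (D.tree k).abuts c₀ = some x₀ ∧
        (∀ g ∈ C, (D.act k g).hom.branchMap c₀ = c₀) ∧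
        ∃ d : (D.tree j).Branch, (D.tree j).edgeOf d = (D.tree j).edgeOf (φ.branchMap c₀) ∧
          (D.tree j).abuts d = some (φ.vertexMap x) := by
    intro x hx hxx₀
    have hA : (D.tree k).subdivision.IsAcyclic := (D.isTree k).isTree.isAcyclic
    obtain ⟨p, hp⟩ := (D.isTree k).isTree.connected.exists_isPath (Sum.inl x₀) (Sum.inl x)
    have hlen : 0 < p.length := by
      by_contra h0
      have h0' : p.length = 0 := by omega
      exact hxx₀ (Sum.inl_injective (SimpleGraph.Walk.eq_of_length_eq_zero h0')).symm
    have hP : ∀ z ∈ p.support, ∀ g ∈ C, SemiGraph.nodeMap (D.act k g) z = z := fun z hz g hg =>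
      SemiGraph.nodeMap_eq_self_of_isPath hA (D.act k g) (by simp [SemiGraph.nodeMap, hx₀ g hg])
        (by simp [SemiGraph.nodeMap, hx g hg]) p hp z hz
    obtain ⟨c₀, w, -, hc₀, hPc₀, hwsupp, ⟨d, hde, hdw⟩, hcase⟩ :=
      SemiGraph.exists_endpoint_or_unfolded_of_isPath φ
        (fun z => ∀ g ∈ C, SemiGraph.nodeMap (D.act k g) z = z) p.length p rfl hp hlen hP
    rcases hcase with rfl | ⟨cc, cc', hne, hcc, hcc', hPcc, hPcc', hunf⟩
    · exact ⟨c₀, hc₀, fixB_of_node c₀ hPc₀, d, hde, hdw⟩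
    · exfalso
      refine excl w cc cc' hne hcc hcc' (fun g hg => ⟨fixV_of_node w (hP _ hwsupp) g hg,
        fixB_of_node cc hPcc g hg, fixB_of_node cc' hPcc' g hg⟩) hunf ?_
      -- `φ w` is an end-vertex of the edge of `φ c₀`, a branch at `y`: next to `x̄ j`
      refine Or.inr ⟨(quot j).branchMap (φ.branchMap c₀), (quot j).branchMap d, ?_, ?_, ?_⟩
      · rw [← hqy]; exact (quot j).abuts_branchMap _ _ (φ.abuts_branchMap c₀ x₀ hc₀)
      · rw [(quot j).edgeOf_branchMap, (quot j).edgeOf_branchMap, hde]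
      · exact (quot j).abuts_branchMap _ _ hdw
  -- two fixed branches at `x₀` with distinct images: excluded (a bad pair AT `x̄ j`)
  have same : ∀ (c₁ c₂ : (D.tree k).Branch), (D.tree k).abuts c₁ = some x₀ → (D.tree k).abuts c₂ = some x₀ →
      (∀ g ∈ C, (D.act k g).hom.branchMap c₁ = c₁) → (∀ g ∈ C, (D.act k g).hom.branchMap c₂ = c₂) →
      φ.branchMap c₁ = φ.branchMap c₂ := by
    intro c₁ c₂ hc₁ hc₂ hf₁ hf₂
    by_contra hne
    have hcc : c₁ ≠ c₂ := fun h => hne (by rw [h])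
    exact excl x₀ c₁ c₂ hcc hc₁ hc₂ (fun g hg => ⟨hx₀ g hg, hf₁ g hg, hf₂ g hg⟩) hne (Or.inl hqy)
  -- conclusion
  by_cases hall : ∀ x : (D.tree k).Vertex, (∀ g ∈ C, (D.act k g).hom.vertexMap x = x) →
      φ.vertexMap x = φ.vertexMap x₀
  · exact Or.inl ⟨φ.vertexMap x₀, hall⟩
  · push Not at hall
    obtain ⟨x₁, hx₁, hne₁⟩ := hall
    have hx₁₀ : x₁ ≠ x₀ := fun h => hne₁ (by rw [h])
    obtain ⟨c₁, hc₁, hf₁, -⟩ := R x₁ hx₁ hx₁₀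
    refine Or.inr ⟨(D.tree j).edgeOf (φ.branchMap c₁), fun x hx => ?_⟩
    by_cases hxx₀ : x = x₀
    · subst hxx₀
      exact ⟨φ.branchMap c₁, rfl, φ.abuts_branchMap c₁ _ hc₁⟩
    · obtain ⟨cₓ, hcₓ, hfₓ, d, hde, hdw⟩ := R x hx hxx₀
      refine ⟨d, ?_, hdw⟩
      rw [hde, same cₓ c₁ hcₓ hc₁ hfₓ hf₁]


end Levels

end VerticialLevelData

end ProfiniteSemiGraph

end Literature.AnabelianGeometry.SemiGraphs
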